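import Summits.BirchSwinnertonDyer.BirchSwinnertonDyer.Theorems.EisensteinPrimesBSDpOnCellCOfNamedFactsV23
import Summits.BirchSwinnertonDyer.BirchSwinnertonDyer.Theorems.EisensteinPrimesBSDpOnCellCResidualV11LZZAllP
import HarnessLib

/-!
# Crux 4 `BSDpOnCellC` (stmt-BirchSwinnertonDyer-19034): composition V24 = V23 (no CGLS Prop. 1.2.5) × the LEAD's V22LZZ/all-P residual layer
# (no Castella 2018 Thms. 2.10–2.11) — 21 refereed names in `hPub` (width seat `bsd-line-x2-p2` gen 27; `--supports`, helper; CONDITIONAL)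

`hPub` = V22LZZ's 22-name text (`…OfNamedFactsV22LZZ.bsdpOnCellC_of_namedFactsV22_allP`) with EXACTLY the conjunct
`prop125_characterGrSelmerDual_torsion_muZero_dim` removed = V23's 22-name text with EXACTLY the conjunct `thm210_thm211_bdpDisplay_pNew`
(and its paren pair) removed. Body = V23's (this seat, p796959: Keller–Yin Lemma 5.1.1 by name from
`KellerYinLemma511OfPub.lemma511_OPEN_of_pub_ofSurC`, the non-split imprimitive count from
`ImprimitiveCountNonsplitOfPrimitive.imprimitiveCount_nonsplit_of_an_of_primitive_ofPoitouTateAt`, no `hge`) with the LEAD g9's two V22LZZ edits: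
the destructuring `⟨⟨⟨…⟩, h16⟩, h17⟩ ↦ ⟨⟨…⟩, h17⟩` and the residual layer `BSDpOnCellCResidualV11.…_of_cellB ↦ BSDpOnCellCResidualV11LZZAllP.…_of_cellB_allP`
(Liu–Zhang–Zhang 2018 Thms. 1.5.1/1.5.3 at all p in place of Castella 2018 Thms. 2.10–2.11). The two lanes' edits are disjoint; nothing else changes.
* `bsdpOnCellC_of_namedFactsV24 (hPub : 21 names) (hRβ) (hMember) (hMCB)`; * `bsdpOnCellC_of_namedFactsV24P (hPub) (hPre) (hCar) (hMCB)`.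
HONEST FRAMING: CONDITIONAL re-packaging; by-name 22/23 → 21 IN THIS FILE'S HYPOTHESES ONLY — the registered skeleton (telescope v21 → v22 under
RESHAPE #74) and its `stub_publishedFacts`/`stub_publishedFacts21` are NOT touched by this file and nothing is «redundant» in the registry until a LEAD
re-cuts it under a director word (host (C2)/(C4)); the host watch h-W-CAS-1 (LZZ `p`-range page-check) rides with the all-P layer exactly as for R5/R6;
no summit statement, no BSD / MC / IMC proved; 0 cells / labels / tiers move. THEOREMS ONLY.
-/

set_option autoImplicit false
set_option linter.dupNamespace false

noncomputable section

open scoped Classical MatrixGroups ModularForm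

open CongruenceSubgroup WeierstrassCurve NumberField IsDedekindDomain Field PowerSeries
  Literature.NumberTheory.EllipticCurves Literature.NumberTheory.EllipticCurves.GreenbergSelmer
  Literature.NumberTheory.EllipticCurves.ModularForms Literature.NumberTheory.QuadraticFields
  Literature.NumberTheory.EllipticCurves.Rank1Residual
  Literature.NumberTheory.EllipticCurves.Rank1Residual.Typed
  Literature.NumberTheory.EllipticCurves.KrizLi2019
  Literature.NumberTheory.EllipticCurves.GreenbergVatsal2000
  Literature.NumberTheory.EllipticCurves.Wuthrich2014
  Literature.NumberTheory.EllipticCurves.SteinWuthrich2013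
  Literature.NumberTheory.EllipticCurves.Castella2018Exceptional
  Literature.NumberTheory.GaloisRepresentations Literature.NumberTheory.GaloisCohomology
  Literature.NumberTheory.Automorphic
  Summit.BirchSwinnertonDyer.Rank1Residual.X11b.AcSelmer
  Summit.BirchSwinnertonDyer.Rank1Residual.X11b.Halves
  Summit.BirchSwinnertonDyer.Rank1Residual.X11b
  Summit.BirchSwinnertonDyer.Rank1Residual Summit.BirchSwinnertonDyer.Rank1Residual.X1
  Summit.BirchSwinnertonDyer.Rank1Residual.X2
open Literature.NumberTheory.EllipticCurves.KellerYin2024 (curveLocalLambda)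

namespace Summit.BirchSwinnertonDyer.BirchSwinnertonDyer.Theorems.EisensteinPrimesBSDpOnCellCOfNamedFactsV24

open Literature.NumberTheory.EllipticCurves.CastellaGrossiLeeSkinner2022 Literature.NumberTheory.EllipticCurves.Castella2018
  Literature.NumberTheory.IwasawaTheory Literature.NumberTheory.IwasawaTheory.Greenberg2016
  Literature.NumberTheory.IwasawaTheory.Greenberg2006
  Summit.BirchSwinnertonDyer.Rank1Residual.X1.KellerYinMuLambdaSplit
open Literature.NumberTheory.EllipticCurves.KellerYin2024
open Literature.NumberTheory.EllipticCurves.BigGaloisRep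
open Summit.BirchSwinnertonDyer.BirchSwinnertonDyer.Theorems.TelescopeKernel (kolyvaginDiv_signFree_of_telescope divRbeta_of_signFree)
open Summit.BirchSwinnertonDyer.BirchSwinnertonDyer.Theorems.MemberDivOfThm308 (memberDiv_of_thm308)



/-- **Crux 4 `BSDpOnCellC` BY NAME (V24) — V23 (no CGLS 2022 Prop. 1.2.5) over the LEAD's all-P residual layer (no Castella 2018 Thms. 2.10–2.11):
`hPub`: 21 refereed names** (V23's 22-name text with EXACTLY the conjunct `thm210_thm211_bdpDisplay_pNew` removed = V22LZZ's 22-name text with EXACTLY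
`prop125_characterGrSelmerDual_torsion_muZero_dim` removed), road R-β pair, Keller–Yin 2.2.2 member pair, crux 3. Body =
V23's over `BSDpOnCellCResidualV11LZZAllP.…_of_cellB_allP` (destructuring without `h16`): the Milne clause fed by the tree theorem, no `hge`, Keller–Yin Lemma 5.1.1 from
`KellerYinLemma511OfPub.lemma511_OPEN_of_pub_ofSurC` and the non-split count from
`ImprimitiveCountNonsplitOfPrimitive.imprimitiveCount_nonsplit_of_an_of_primitive_ofPoitouTateAt` (this seat's prop125-free twins, fed the
four names `hPub.2.*`, Milne `hX`, Greenberg by name); everything else token-identical. CONDITIONAL; nothing asserted.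
[claim: KellerYin2024, status: under-review] [cite: KellerYin2024, Thm. 5.1.3, Thm. 2.2.2 (arXiv:2402.12781v2) (shape only)]
[cite: MilneADT2006, Ch. I, Thm. 4.10 (a) p. 57] [cite: CastellaGrossiLeeSkinner2022, Cor. 1.2.6, Thm. 2.1.2] [cite: Greenberg2016Selmer, Prop. 2.6.3 (c)]
[cite: BleherEtAl2020, §3.3 Thm. 3.3.1] [cite: deShalit1987, II.6.4] [cite: Hida2010MuInvariant, Thm. I] [cite: Greenberg2006, Props. 3.2, 4.1, 4.2, §5 A] -/
theorem bsdpOnCellC_of_namedFactsV24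
    (hPub :
    (((lambdaMu_multiplicative_of_gvPar ∧ thm16_charIdeal_dvd_multiplicative_of_reducible ∧
    thm61_splitMultiplicative ∧ thm61_nonsplitMultiplicative ∧
    (∀ (W : WeierstrassCurve ℚ) [W.IsElliptic] [W.IsGloballyMinimal] (p : ℕ) [Fact p.Prime],
      greenberg_stevens (W := W) (p := p)) ∧
    exists_isNewformOf ∧
    hsieh2014_exists_anticyclotomicPAdicLFunction ∧
    (∀ (N : ℕ) [NeZero N] (W : WeierstrassCurve ℚ) (K : Type) [Field K] [NumberField K],
      gross_zagier N W K) ∧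
    (∀ (N : ℕ) [NeZero N] (W : WeierstrassCurve ℚ) (K : Type) [Field K] [NumberField K],
      kolyvagin N W K) ∧
    rank_eq_analyticRank_of_analyticRank_le_one ∧ HoffsteinLuo1997_exists_twist_L_one_ne_zero ∧
    mazur_not_dvd_maninConstant_of_odd ∧ bsdRHS_eq_of_isIsogenous) ∧
    LiuZhangZhang2018.thm151_thm153_modularCurve_heegnerVector) ∧
    (cor126_residualCharacter_globalLift ∧ cor126_residualCharacter_localSurjective ∧
      thm212_exists_isKatzLFunction ∧
      Literature.NumberTheory.EllipticCurves.Castella2018.cas20_thm211_memberForms_sigmaFrames_congr)) ∧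
      Literature.NumberTheory.EllipticCurves.BCGKPST2020.thm331_rubin_exists_katzMeasure₂_pseudoIso_span_eq ∧
      Literature.NumberTheory.EllipticCurves.DeShalit1987.thmII64_katzMeasure₂_functionalEquation ∧
      Literature.NumberTheory.EllipticCurves.Hida2010MuInvariant.thmI_mu_katzBranch_reflect_eq_zero)
    (hRβ :
    (∀ (W : WeierstrassCurve ℚ) [W.IsElliptic] [W.IsGloballyMinimal] (p : ℕ) [Fact p.Prime],
      CellC W p → ¬ W.HasSplitMultiplicativeReductionAtPrime p → NonsplitKolyvaginDivOnTreeIntOther W p) ∧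
    (∀ (W : WeierstrassCurve ℚ) [W.IsElliptic] [W.IsGloballyMinimal] (p : ℕ) [Fact p.Prime],
      CellC W p → W.HasSplitMultiplicativeReductionAtPrime p → SplitKolyvaginDivOnTreeIntOther W p))
    (hMember :
    Literature.NumberTheory.EllipticCurves.KellerYin2024.thm222_anacong_hidaMember_sigma_mu_OPEN ∧
      Literature.NumberTheory.EllipticCurves.KellerYin2024.thm222_anacong_hidaMember_sigma_lambda_OPEN)
    (hMCB :
    Summit.BirchSwinnertonDyer.BirchSwinnertonDyer.Theses.EisensteinPrimes.MazurMCOnCellB)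
        : Summit.BirchSwinnertonDyer.BirchSwinnertonDyer.Theses.EisensteinPrimes.BSDpOnCellC := by
  -- b1's 17-tuple REBUILT (the two Poitou–Tate conjuncts are tree theorems, bsd-schneider door-c4 g18), as in V10; V22LZZ destructuring (no h16)
  obtain ⟨⟨h1, h2, h3, h4, h5, h6, h9, h10, h11, h12, h13, h14, h15⟩, h17⟩ := hPub.1.1
  obtain ⟨hcg, hcl, h212, hcas⟩ := hPub.1.2
  -- Milne ADT I Thm. 4.10 (a) at totally complex fields: the x1 lane's END theorem (as in V22)
  have hX : ∀ (L : Type) [Field L] [NumberField L] [IsTotallyComplex L] (S : Set (IsDedekindDomain.HeightOneSpectrum (𝓞 L))),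
      S.Finite → Literature.NumberTheory.GaloisCohomology.poitouTate_shaRestricted_tateDual_natural_at L S :=
    PoitouTateShaNaturalAtTC.forall_poitouTate_shaRestricted_tateDual_natural_at_of_isTotallyComplex
  -- Greenberg 2016 Prop. 2.6.3 (c) / CGLS Prop. 1.2.5's SUR input at totally complex `K` from the Milne clause (as in V19)
  have h263 := Summit.BirchSwinnertonDyer.BirchSwinnertonDyer.Theorems.SurLambda.prop263_sur_of_crk_caseC_tc_of_poitouTateNaturalAt hX
  -- the WALL ([BR𝟙-anom] ∧ [BRω-split] LIGHT) from the three appended PUBLISHED names + the Milne clause (prop411 DROP, this seat)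
  have hWall := Summit.BirchSwinnertonDyer.BirchSwinnertonDyer.Theorems.BSDpOnCellCWallAlgebraicOfPub.wallAlgebraic_ofPoitouTateAt
    hPub.2.1 hX hPub.2.2.1 hPub.2.2.2
  -- Greenberg 2006 Props. 4.1 / 4.2 / 3.2 / §5 A: TREE THEOREMS (V13, V12, V14, LEAD g0), fed by name below
  have h41 : prop41_globalEulerPoincareCorank :=
    Literature.NumberTheory.IwasawaTheory.Greenberg2006.prop41_of_tate_of_poitouTate_three_le_of_isTotallyComplex
      Literature.NumberTheory.GaloisCohomology.forall_tateGlobalEulerPoincareCharacteristic_of_isTotallyComplex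
      Literature.NumberTheory.GaloisCohomology.forall_poitouTate_restricted_three_le_of_isTotallyComplex
  have h42 : prop42_localEulerPoincareCorank :=
    Literature.NumberTheory.IwasawaTheory.Greenberg2006.LocalEulerPoincareCorank.prop42_localEulerPoincareCorank_holds
  have h32 : prop32_cohomology_isCofinitelyGenerated :=
    Literature.NumberTheory.IwasawaTheory.Greenberg2006.prop32_cohomology_isCofinitelyGenerated_holds
  have h5A : sec5A_localH2_subsingleton_of_LOC1 :=
    Literature.NumberTheory.IwasawaTheory.Greenberg2006.sec5A_localH2_subsingleton_of_LOC1_holds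
  -- (i) ∧ (ii′) at the crystalline member and the fibre congruence (I), as in V10
  have hMemberI := Summit.BirchSwinnertonDyer.BirchSwinnertonDyer.Theorems.MemberInvariantsOfAnacongWt.memberInvariants_of_anacongWt hMember.1 hMember.2
  have hFibre := Summit.BirchSwinnertonDyer.BirchSwinnertonDyer.Theorems.CrystallineFibreOfCas20.crystallineFibre_of_cas20 hcas
  exact Summit.BirchSwinnertonDyer.BirchSwinnertonDyer.Theorems.BSDpOnCellCResidualV11LZZAllP.bsdpOnCellC_of_publishedFacts_of_divIntOther_of_lemma511_OPEN_of_muFrame_of_imprimitiveCount_of_cellB_allP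
    ⟨⟨h1, h2, h3, h4, h5, h6, fun K _ _ ↦ Summit.BirchSwinnertonDyer.BirchSwinnertonDyer.Theorems.SchneiderFreeAdditiveX3.PoitouTateReduction.poitouTate_selmerStructure_duality_holds K,
        fun K _ _ ↦ Summit.BirchSwinnertonDyer.BirchSwinnertonDyer.Theorems.SchneiderFreeAdditiveX3.PoitouTateReduction.poitouTate_sha_tateDual_holds K, h9, h10, h11, h12, h13, h14, h15⟩, h17⟩
    hRβ.1 hRβ.2
    (Summit.BirchSwinnertonDyer.BirchSwinnertonDyer.Theorems.KellerYinLemma511OfPub.lemma511_OPEN_of_pub_ofSurC hPub.2.1 hX hPub.2.2.1 hPub.2.2.2 h263 h41 h42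
      h5A h212 hWall.1 hWall.2)
    (Summit.BirchSwinnertonDyer.BirchSwinnertonDyer.Theorems.CrystalTransports.muFrame_of_crystallineFibre_of_memberMuZero hFibre hMemberI.1).1
    (Summit.BirchSwinnertonDyer.BirchSwinnertonDyer.Theorems.CrystalTransports.muFrame_of_crystallineFibre_of_memberMuZero hFibre hMemberI.1).2
    (Summit.BirchSwinnertonDyer.BirchSwinnertonDyer.Theorems.ImprimitiveCountNonsplitOfPrimitive.imprimitiveCount_nonsplit_of_an_of_primitive_ofPoitouTateAt h263 h5A hcg hcl hX h41 h42 h32 h212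
      hPub.2.1 hPub.2.2.1 hPub.2.2.2
      (Summit.BirchSwinnertonDyer.BirchSwinnertonDyer.Theorems.CrystalTransports.han_of_crystallineFibre_of_memberInvariants hFibre
        Summit.BirchSwinnertonDyer.BirchSwinnertonDyer.Theorems.CrystalLambdaSigma.lambda_sigmaEulerElement
        (Summit.BirchSwinnertonDyer.BirchSwinnertonDyer.Theorems.CrystalTransports.memberLambdaCount_of_free hMemberI.2)))
    (Summit.BirchSwinnertonDyer.BirchSwinnertonDyer.Theorems.ImprimitiveCountSplitTransport.imprimitiveCount_split_of_hlatLight h6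
      (Summit.BirchSwinnertonDyer.BirchSwinnertonDyer.Theorems.SplitMultWallHlatLight.imprimitiveCount_split_hlatLight_of_brAnom_of_pub_tc_ofSurC h263 h41 h42 h5A h32 h212 hWall.1
        (Summit.BirchSwinnertonDyer.BirchSwinnertonDyer.Theorems.ImprimitiveCountWallOfInputs.brOmegaSplit_medium_of_light hWall.2)
        (Summit.BirchSwinnertonDyer.BirchSwinnertonDyer.Theorems.CrystalTransports.hanSplitLight_of_crystallineFibre_of_memberInvariants hFibre
          Summit.BirchSwinnertonDyer.BirchSwinnertonDyer.Theorems.CrystalLambdaSigma.lambda_sigmaEulerElement hMemberI.2)))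
    hMCB


-- unifying the kernel's conclusion with the road-R-β binder pair exceeds the default budget (as V16T…V21P)
set_option maxHeartbeats 1600000 in
/-- **Crux 4 `BSDpOnCellC` BY NAME from the stub texts WITHOUT CGLS Prop. 1.2.5 AND WITHOUT Castella 2018 Thms. 2.10–2.11 (V24P)**: `hPub` = 21 refereed
names (v21's `stub_publishedFacts` text with EXACTLY the prop125 and the thm210_thm211 conjuncts removed = telescope v22's `stub_publishedFacts21` text
with EXACTLY the prop125 conjunct removed and `kolyvagin` kept), `hPre` = the three Keller–Yin statements (v21/v22's `stub_preprintFacts3` text), `hCar` =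
the v1 carrier text verbatim, `hMCB` = crux 3. CONDITIONAL. Twin of V23P / V22LZZ's `…V22P_allP`. [cite: LiuZhangZhang2018, Thms. 1.5.1, 1.5.3 (shape only)]
[cite: BleherEtAl2020, §3.3 Thm. 3.3.1] [cite: deShalit1987, II.6.4] [cite: Hida2010MuInvariant, Thm. I] [claim: KellerYin2024, status: under-review]
[cite: KellerYin2024, Thm. 3.0.8, Thm. 2.2.2 (arXiv:2402.12781v2) (shape only)] [cite: Castella2020JIMJ, Def. 2.10 and Thm. 2.11 (shape only)] -/
theorem bsdpOnCellC_of_namedFactsV24P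
    (hPub :
    (((lambdaMu_multiplicative_of_gvPar ∧ thm16_charIdeal_dvd_multiplicative_of_reducible ∧
    thm61_splitMultiplicative ∧ thm61_nonsplitMultiplicative ∧
    (∀ (W : WeierstrassCurve ℚ) [W.IsElliptic] [W.IsGloballyMinimal] (p : ℕ) [Fact p.Prime],
      greenberg_stevens (W := W) (p := p)) ∧
    exists_isNewformOf ∧
    hsieh2014_exists_anticyclotomicPAdicLFunction ∧
    (∀ (N : ℕ) [NeZero N] (W : WeierstrassCurve ℚ) (K : Type) [Field K] [NumberField K],
      gross_zagier N W K) ∧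
    (∀ (N : ℕ) [NeZero N] (W : WeierstrassCurve ℚ) (K : Type) [Field K] [NumberField K],
      kolyvagin N W K) ∧
    rank_eq_analyticRank_of_analyticRank_le_one ∧ HoffsteinLuo1997_exists_twist_L_one_ne_zero ∧
    mazur_not_dvd_maninConstant_of_odd ∧ bsdRHS_eq_of_isIsogenous) ∧
    LiuZhangZhang2018.thm151_thm153_modularCurve_heegnerVector) ∧
    (cor126_residualCharacter_globalLift ∧ cor126_residualCharacter_localSurjective ∧
      thm212_exists_isKatzLFunction ∧
      Literature.NumberTheory.EllipticCurves.Castella2018.cas20_thm211_memberForms_sigmaFrames_congr)) ∧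
      Literature.NumberTheory.EllipticCurves.BCGKPST2020.thm331_rubin_exists_katzMeasure₂_pseudoIso_span_eq ∧
      Literature.NumberTheory.EllipticCurves.DeShalit1987.thmII64_katzMeasure₂_functionalEquation ∧
      Literature.NumberTheory.EllipticCurves.Hida2010MuInvariant.thmI_mu_katzBranch_reflect_eq_zero)
    (hPre :
    Literature.NumberTheory.EllipticCurves.KellerYin2024.thm308_imc2_hidaMember_dvd_OPEN ∧
      Literature.NumberTheory.EllipticCurves.KellerYin2024.thm222_anacong_hidaMember_sigma_mu_OPEN ∧
      Literature.NumberTheory.EllipticCurves.KellerYin2024.thm222_anacong_hidaMember_sigma_lambda_OPEN)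
    (hCar :
    ∀ (W : WeierstrassCurve ℚ) [W.IsElliptic] [W.IsGloballyMinimal] (p : ℕ) [Fact p.Prime],
    ∀ (N : ℕ) [NeZero N] (K : Type) [Field K] [NumberField K] (Dt : ModularParametrizationData W N)
      (H : HeegnerDatum N (NumberField.discr K)) (ιK : K →+* ℂ) (P : (W.baseChange K).toAffine.Point),
      CellC W p → W.conductorNorm ℤ = N →
      IsImaginaryQuadratic K → NumberField.discr K < -4 → SatisfiesHeegnerHypothesis N K →
      (W.quadraticTwist (NumberField.discr K : ℚ)).entireLFunction 1 ≠ 0 →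
      WeierstrassCurve.Affine.Point.map ιK.toRatAlgHom P = heegnerPointComplex Dt H →
      ¬ (p : ℤ) ∣ Dt.c → ¬ IsOfFinAddOrder P →
      Odd (NumberField.discr K) →
      ∀ (κ : ZpExtension K p), κ.IsAnticyclotomic →
        ∀ (γ : Field.absoluteGaloisGroup K) [Fact (κ.IsTopGenerator γ)]
          (𝔭 : HeightOneSpectrum (𝓞 K)), ((p : ℕ) : 𝓞 K) ∈ 𝔭.asIdeal →
          𝔭.asIdeal.ramificationIdx (𝓞 ℚ) = 1 → 𝔭.asIdeal.inertiaDeg (𝓞 ℚ) = 1 →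
          ∀ (𝔭bar : HeightOneSpectrum (𝓞 K)), ((p : ℕ) : 𝓞 K) ∈ 𝔭bar.asIdeal → 𝔭bar ≠ 𝔭 →
            ((Ideal.span {(p : ℤ)}).primesOver (𝓞 K)).ncard = 2 →
          ∀ (f : CuspForm (CongruenceSubgroup.Gamma0 N) 2), IsNewformOf W f →
            ∀ (ι' : PadicAlgCl p ≃+* ℂ),
              (∀ (w : InfinitePlace K) (k : 𝓞 K),
                k ∈ 𝔭.asIdeal ↔ ‖ι'.symm (w.embedding (k : K))‖ < 1) →
              ∀ (ΩK : ℂ) (Ωp : ℂ_[p]) (Q : PowerSeries 𝓞_ℂ_[p]), ΩK ≠ 0 → ‖Ωp‖ = 1 →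
                R1.IsBDPLFunctionInt p ι' 𝔭 κ γ f ΩK Ωp Q →
      ∃ (F L : PowerSeries (PowerSeries (unrIntegers p))) (x : ℕ → ℤ_[p]),
        (∀ k, ‖x k‖ < 1) ∧ Filter.Tendsto x Filter.atTop (nhds 0) ∧
        ¬ (PowerSeries.C (PowerSeries.X : PowerSeries (unrIntegers p)) ∣ F) ∧
        (∃ j : ℕ, PowerSeries.C ((p : 𝓞_ℂ_[p]) ^ j) *
            PowerSeries.map (R1.unrToCpInt p) (PowerSeries.map (PowerSeries.constantCoeff (R := unrIntegers p)) F) ∈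
          (XAc.charIdeal (W.baseChange K) p κ 𝔭bar ∅ γ).map (PowerSeries.map (R1.toCpInt p))) ∧
        (∃ e : ℕ, PowerSeries.C ((p : 𝓞_ℂ_[p]) ^ e) * Q ∈
          Ideal.span {PowerSeries.map (R1.unrToCpInt p) (PowerSeries.map (PowerSeries.constantCoeff (R := unrIntegers p)) L)}) ∧
        ∀ k : ℕ, ∃ (D : Skinner2016.HidaCongruentForm W p 1),
          (∀ y : coeffField D.g, ι' (D.ι y) = (y : ℂ)) ∧ 2 * ((p : ℤ) - 1) ∣ D.k - 2 ∧
          ∃ (ΩKg : ℂ) (Ωpg : ℂ_[p]) (Lg : UnrSeries p), ΩKg ≠ 0 ∧ ‖Ωpg‖ = 1 ∧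
            IsBDPLFunctionWt ι' 𝔭 κ γ D.g ΩKg Ωpg Lg ∧
          ∃ (Φ Ψ : UnrSeries p),
            (∃ G U : PowerSeries (PowerSeries (unrIntegers p)),
              PowerSeries.map (PowerSeries.C (R := unrIntegers p)) Φ =
                F * G + PowerSeries.C (PowerSeries.X - PowerSeries.C (toUnr p (x k))) * U) ∧
            (∃ U : PowerSeries (PowerSeries (unrIntegers p)),
              PowerSeries.map (PowerSeries.C (R := unrIntegers p)) Ψ =
                L + PowerSeries.C (PowerSeries.X - PowerSeries.C (toUnr p (x k))) * U) ∧
            (∃ e : ℕ, PowerSeries.C ((p : 𝓞_ℂ_[p]) ^ e) * PowerSeries.map (R1.unrToCpInt p) Ψ ∈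
              Ideal.span {PowerSeries.map (R1.unrToCpInt p) Lg}) ∧
            ∀ (b : padicCoeffIntegers D.ι →+* 𝓞_ℂ_[p]),
              (∀ y, ((b y : 𝓞_ℂ_[p]) : ℂ_[p]) =
                algebraMap (PadicAlgCl p) ℂ_[p] (padicCoeffIntegers.toPadicAlgCl D.ι y)) →
            ∀ [TopologicalSpace (PowerSeries (padicCoeffIntegers D.ι))]
              [ContinuousSMul (PowerSeries (padicCoeffIntegers D.ι))
                (BigRepModule (padicCoeffIntegers D.ι) p (Cofree D.Δ.selfDualRep (padicCoeffField D.ι)))],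
              ∃ j : ℕ, Ideal.span {PowerSeries.C ((p : 𝓞_ℂ_[p]) ^ j)} *
                  (XBig.charIdeal κ (D.Δ.selfDualCofreeRepOver K) 𝔭bar
                    (∅ : Set (HeightOneSpectrum (𝓞 K)))).map (PowerSeries.map b) ≤
                Ideal.span {PowerSeries.map (R1.unrToCpInt p) Φ})
    (hMCB :
    Summit.BirchSwinnertonDyer.BirchSwinnertonDyer.Theses.EisensteinPrimes.MazurMCOnCellB)
        : Summit.BirchSwinnertonDyer.BirchSwinnertonDyer.Theses.EisensteinPrimes.BSDpOnCellC :=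
  bsdpOnCellC_of_namedFactsV24 hPub (divRbeta_of_signFree (kolyvaginDiv_signFree_of_telescope (memberDiv_of_thm308 hPre.1) hCar))
    ⟨hPre.2.1, hPre.2.2⟩ hMCB

end Summit.BirchSwinnertonDyer.BirchSwinnertonDyer.Theorems.EisensteinPrimesBSDpOnCellCOfNamedFactsV24

end
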